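import Summits.BirchSwinnertonDyer.BirchSwinnertonDyer.Theorems.PrintCFramBottomClassIndexLawFiveLeHerbrandOddIrregularWitness
import Summits.BirchSwinnertonDyer.BirchSwinnertonDyer.Theorems.PrintCFramBottomClassIndexLawFiveLeHerbrandOddUnramifiedEquivariant
import Literature.NumberTheory.NumberFields.HilbertClassFieldOfGaloisExtension
import Literature.NumberTheory.NumberFields.UnramifiedCompositum
import Literature.NumberTheory.GaloisRepresentations.AbsGaloisGroupProofs
import HarnessLib

/-!
# Route `PrintCFram`, crux C2 `BottomClassIndexLawFiveLe` (stmt-BirchSwinnertonDyer-20372), line `eisenstein-resource-bdp-line`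
# (registry v17/v18): THE IRREGULARITY WITNESS ON `Γ_L` — the Hilbert-class-field Artin map is `Γ_ℚ`-EQUIVARIANT, so a non-zero
# `θ̄`-equivariant character of `Cl(L)` lifts to a non-zero everywhere-unramified character of `Γ_L` with the eigen-law under the
# outer `Γ_ℚ`-action (the converse of stub O's `absGaloisHom_eq_one_final`)

Cell `bsd-print-cfram`, width seat `bsd-line-cfram-p1-w6` (generation g2); `--supports stmt-BirchSwinnertonDyer-20372` (helper).
THEOREMS ONLY (0 definitions, 0 named facts, 0 `sorry`); tree-only. Sequel of `…HerbrandOddIrregularWitness` (class-group half).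

HONEST FRAMING. The crux C2 is CLASS-WIDE and stays OPEN; nothing about BSD is proved here; no summit statement is proved by this seat;
no stub is closed. §3's Mazur–Wiles form is CONDITIONAL on the named fact `MazurWiles1984.thm2_card_oddChiClassGroup_eq_bernoulli` (Ribet
direction); §§1–2 are unconditional.

WHAT IS PROVED.
* §1 **`smul_absGaloisOuterConj`**: the outer action `θ_τ = absGaloisOuterConj ℚ L τ` of `τ ∈ Γ_ℚ` on `Γ_L` is conjugation by the
  transported automorphism `T = ι ∘ τ ∘ ι⁻¹` of `L̄` (`ι = GaloisRepresentations.absClosureEquiv ℚ L : ℚ̄ ≃ L̄`): `(θ_τ σ) • y = T (σ • T⁻¹ y)`;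
  **`absRestrictNormalHom_absGaloisOuterConj_eq_one`**: `θ_τ` preserves `Γ_H = ker(Γ_L → Gal(H/L))`, `H` the Hilbert class field
  (`H` is stable under `Aut_ℚ(L̄)`: `hilbertClassField.map_algEquiv_le`);
  **`artin_absGaloisOuterConj`** — FULL `Γ_ℚ`-EQUIVARIANCE OF THE HILBERT-CLASS-FIELD ARTIN MAP: for every `γ ∈ Γ_ℚ`, `σ ∈ Γ_L`,
  `Art(θ_γ σ) = γ̄ • Art(σ)` (`Art σ = artinEquiv⁻¹(σ|_H)`, `γ̄ = absGaloisQuot ℚ L γ` acting on `Cl(𝓞 L)` through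
  `ClassGroup.mulEquiv (AmbiguousClass.intAut γ̄)`). The engine's `classGroupHom_mulEquiv_eq_pow` (w6 g0) is the Frobenius-level shadow;
  here: `σ ↦ Art(θ_γ σ)` factors through `Art` (Γ_H-stability), and the factor agrees with `γ̄ •` on prime classes (Frobenius at `𝔔 ∣ w`
  goes to Frobenius at `γ ⋆ 𝔔 ∣ γ̄ w`, `isArithFrobAt_absGaloisOuterConj_iff`), which generate `Cl`.
* §2 **`exists_absGaloisHom_ne_one_of_chiComponent_ne_bot`**: `L/ℚ` abelian, `p ∤ [L:ℚ]`, `ψ : Gal(L/ℚ) →* ℤ_pˣ` with reduction `θ̄`,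
  `r : Γ_ℚ →* 𝔽_pˣ` with `r τ = θ̄(τ̄)`: `e_ψ(ℤ_p ⊗ Cl L) ≠ ⊥ ⟹ ∃ κ : Γ_L →* 𝔽_p` (multiplicative copy), `κ ≠ 1`, OPEN kernel, killing
  EVERY inertia group, with the eigen-law `κ(θ_γ σ) = κ(σ)^{r(γ)}` — the NEGATION of the hypothesis-conclusion shape of stub O's
  `absGaloisHom_eq_one_final[_unconditional]` (`κ = g ∘ Art` for the `g` of `exists_classGroupHom_ne_one_of_chiComponent_ne_bot`).
* §3 **`exists_absGaloisHom_ne_one_of_norm_bernoulli_lt_one`** (CONDITIONAL on Mazur–Wiles, Ribet direction): `χ` primitive odd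
  non-Teichmüller with Galois avatar `φ = χ ∘ χ_f` trivial on `Γ_L`, `0 < ‖B_{1,χ⁻¹}‖_p < 1` ⟹ such a `κ` exists for `r = φ mod p`.
  READING: at the members of v17's residue B1 (class factor non-unit) the field-theoretic frame is IRREGULAR — an everywhere-unramified
  non-zero odd-eigen character exists —, which is the class-group source for report-lead-g10 §4 (β) (w4 g8's `LevelDictionary`
  supplies the Kummer side). beyond-print theorem: NO. BSD is not proved by any of this.

References: [NeukirchANT1999] Ch. IV §6, Ch. VI §7 Thm. (7.1); [Washington1997] Thm. 10.4 (proof), §6.3; [Cox2013] §5.C Lemma 5.28,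
§8.A Thm. 8.10; [MazurWiles1984] Thm. 2 (p. 216) via [Solomon1990] §I p. 468.
-/

set_option autoImplicit false
-- `…BirchSwinnertonDyer.BirchSwinnertonDyer.Theorems…` is the problem's mandated namespace (D-0017).
set_option linter.dupNamespace false

noncomputable section

open NumberField Field IsDedekindDomain
open Literature.NumberTheory
open Literature.NumberTheory.GaloisRepresentations Literature.NumberTheory.NumberFields
open Literature.NumberTheory.EllipticCurves Literature.NumberTheory.LFunctions
open scoped Pointwise nonZeroDivisors

namespace Summit.BirchSwinnertonDyer.BirchSwinnertonDyer.Theorems.PrintCFram.HerbrandOddClassGroup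

/-! ## §1 The Hilbert-class-field Artin map is `Γ_ℚ`-equivariant -/

section Equivariance

variable (L : Type) [Field L] [NumberField L]

/-- **The outer action is conjugation by a transported automorphism of `L̄`.** With `ι = GaloisRepresentations.absClosureEquiv ℚ L : ℚ̄ ≃ₐ[ℚ] L̄` and
`T = ι ∘ τ ∘ ι⁻¹ : L̄ ≃ₐ[ℚ] L̄`: `(absGaloisOuterConj ℚ L τ σ) • y = T (σ • T⁻¹ y)` for all `y ∈ L̄`
(`res(θ_τ σ) = τ · res σ · τ⁻¹` read through `ι (res σ • x) = σ • ι x`). [cite: NeukirchANT1999, Ch. IV §1 (conjugate automorphisms)] -/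
theorem smul_absGaloisOuterConj [IsGalois ℚ L] (τ : absoluteGaloisGroup ℚ) (σ : absoluteGaloisGroup L) (y : AlgebraicClosure L) :
    absGaloisOuterConj ℚ L τ σ • y =
      (((GaloisRepresentations.absClosureEquiv ℚ L).symm.trans (absoluteGaloisGroup.toAlgEquiv ℚ τ)).trans
          (GaloisRepresentations.absClosureEquiv ℚ L))
        (σ • (((GaloisRepresentations.absClosureEquiv ℚ L).symm.trans (absoluteGaloisGroup.toAlgEquiv ℚ τ)).trans
          (GaloisRepresentations.absClosureEquiv ℚ L)).symm y) := by
  set e := GaloisRepresentations.absClosureEquiv ℚ L with he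
  obtain ⟨x, rfl⟩ := e.surjective y
  have hres : ∀ (ρ : absoluteGaloisGroup L) (z : AlgebraicClosure ℚ), e (absGaloisRestrict ℚ L ρ • z) = ρ • e z :=
    fun ρ z => by rw [he, GaloisRepresentations.absClosureEquiv_apply]; exact absGaloisRestrict_apply_smul ℚ L ρ z
  rw [← hres, absGaloisRestrict_absGaloisOuterConj, mul_smul, mul_smul]
  simp only [AlgEquiv.trans_apply, AlgEquiv.symm_trans_apply, AlgEquiv.symm_symm, AlgEquiv.symm_apply_apply]
  rw [← hres, AlgEquiv.symm_apply_apply, absoluteGaloisGroup.smul_def τ, absoluteGaloisGroup.smul_def τ⁻¹, map_inv,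
    AlgEquiv.aut_inv]

variable [IsGalois ℚ L]

/-- **`θ_τ` preserves `Γ_H`**, `H = hilbertClassField L`: if `σ` fixes `H` pointwise then so does `absGaloisOuterConj ℚ L τ σ`
(`T⁻¹(H) ⊆ H` for the transported `ℚ`-automorphism `T⁻¹` of `L̄`: `hilbertClassField.map_algEquiv_le`, Washington Thm. 10.4).
[cite: Washington1997, Thm. 10.4 (proof)] [cite: Cox2013, §5.C Lemma 5.28] -/
theorem absRestrictNormalHom_absGaloisOuterConj_eq_one (τ : absoluteGaloisGroup ℚ) {σ : absoluteGaloisGroup L}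
    (hσ : absRestrictNormalHom (hilbertClassField L) σ = 1) :
    absRestrictNormalHom (hilbertClassField L) (absGaloisOuterConj ℚ L τ σ) = 1 := by
  set T : AlgebraicClosure L ≃ₐ[ℚ] AlgebraicClosure L :=
    ((GaloisRepresentations.absClosureEquiv ℚ L).symm.trans (absoluteGaloisGroup.toAlgEquiv ℚ τ)).trans
      (GaloisRepresentations.absClosureEquiv ℚ L) with hT
  rw [absRestrictNormalHom_eq_one_iff_forall_smul] at hσ ⊢
  intro h
  have hmem : T.symm (h : AlgebraicClosure L) ∈ hilbertClassField L := by
    have hle := hilbertClassField.map_algEquiv_le (K := ℚ) L T.symm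
    exact hle ⟨(h : AlgebraicClosure L), h.2, rfl⟩
  rw [smul_absGaloisOuterConj]
  show T (σ • T.symm (h : AlgebraicClosure L)) = h
  rw [hσ ⟨_, hmem⟩, AlgEquiv.apply_symm_apply]

/-- **THE HILBERT-CLASS-FIELD ARTIN MAP IS `Γ_ℚ`-EQUIVARIANT.** For `L/ℚ` Galois, `γ ∈ Γ_ℚ`, `σ ∈ Γ_L`:
`artinEquiv⁻¹((θ_γ σ)|_H) = γ̄ • artinEquiv⁻¹(σ|_H)`, where `θ_γ = absGaloisOuterConj ℚ L γ`, `H = hilbertClassField L`,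
`γ̄ = absGaloisQuot ℚ L γ ∈ Gal(L/ℚ)` acts on `Cl(𝓞 L)` by `ClassGroup.mulEquiv (AmbiguousClass.intAut γ̄)`. Proof: `σ ↦ Art(θ_γ σ)`
kills `Γ_H` (`absRestrictNormalHom_absGaloisOuterConj_eq_one`), so it factors through the surjection `Art : Γ_L ↠ Cl(𝓞 L)`; the factor
agrees with `γ̄ •` on every prime class `[w]` — a Frobenius `σ_w` at `𝔔 ∣ w` has `Art σ_w = [w]` and `θ_γ σ_w` is a Frobenius at
`γ ⋆ 𝔔 ∣ γ̄ w` (`isArithFrobAt_absGaloisOuterConj_iff`) — and the prime classes generate (`ClassGroup.closure_mk0_prime_not_mem_eq_top`).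
[cite: NeukirchANT1999, Ch. IV §6 (functoriality of the reciprocity map) and Ch. VI §7 Thm. (7.1)] [cite: Washington1997, Thm. 10.4] -/
theorem artin_absGaloisOuterConj (γ : absoluteGaloisGroup ℚ) (σ : absoluteGaloisGroup L) :
    (hilbertClassField.artinEquiv L).symm (absRestrictNormalHom (hilbertClassField L) (absGaloisOuterConj ℚ L γ σ)) =
      ClassGroup.mulEquiv (AmbiguousClass.intAut (absGaloisQuot ℚ L γ))
        ((hilbertClassField.artinEquiv L).symm (absRestrictNormalHom (hilbertClassField L) σ)) := by
  classical
  -- the two homomorphisms `Γ_L → Cl(𝓞 L)`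
  set Art : absoluteGaloisGroup L →* ClassGroup (𝓞 L) :=
    (hilbertClassField.artinEquiv L).symm.toMonoidHom.comp (absRestrictNormalHom (hilbertClassField L)) with hArt
  have hArt_apply : ∀ ρ : absoluteGaloisGroup L,
      Art ρ = (hilbertClassField.artinEquiv L).symm (absRestrictNormalHom (hilbertClassField L) ρ) := fun ρ => rfl
  set A : absoluteGaloisGroup L →* ClassGroup (𝓞 L) := Art.comp (absGaloisOuterConj ℚ L γ).toMonoidHom with hA
  have hA_apply : ∀ ρ : absoluteGaloisGroup L,
      A ρ = (hilbertClassField.artinEquiv L).symm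
        (absRestrictNormalHom (hilbertClassField L) (absGaloisOuterConj ℚ L γ ρ)) := fun ρ => rfl
  -- `A` kills `ker Art`, hence factors through the surjection `Art`
  have hsurj : Function.Surjective Art := fun c => by
    obtain ⟨ρ, hρ⟩ := absRestrictNormalHom_surjective (hilbertClassField L) (hilbertClassField.artinEquiv L c)
    exact ⟨ρ, by rw [hArt_apply, hρ, MulEquiv.symm_apply_apply]⟩
  have hker : Art.ker ≤ A.ker := by
    intro ρ hρ
    rw [MonoidHom.mem_ker, hArt_apply, MulEquiv.map_eq_one_iff] at hρ
    rw [MonoidHom.mem_ker, hA_apply, MulEquiv.map_eq_one_iff]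
    exact absRestrictNormalHom_absGaloisOuterConj_eq_one L γ hρ
  set a : ClassGroup (𝓞 L) →* ClassGroup (𝓞 L) :=
    Art.liftOfRightInverse (Function.surjInv hsurj) (Function.rightInverse_surjInv hsurj) ⟨A, hker⟩ with ha
  have ha_comp : ∀ ρ : absoluteGaloisGroup L, a (Art ρ) = A ρ := fun ρ =>
    Art.liftOfRightInverse_comp_apply (Function.surjInv hsurj) (Function.rightInverse_surjInv hsurj) ⟨A, hker⟩ ρ
  -- `a` and `γ̄ •` agree on prime classes
  have hagree : a = (ClassGroup.mulEquiv (AmbiguousClass.intAut (absGaloisQuot ℚ L γ))).toMonoidHom := by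
    refine MonoidHom.eq_of_eqOn_dense (ClassGroup.closure_mk0_prime_not_mem_eq_top (R := 𝓞 L) ∅) ?_
    rintro _ ⟨w, -, rfl⟩
    obtain ⟨𝔔, h𝔔⟩ := HeightOneSpectrum.primesAbove_nonempty w
    obtain ⟨ρ, hρ⟩ := HeightOneSpectrum.exists_isArithFrobAt_of_mem_primesAbove_holds (K := L) (v := w) h𝔔
    have hρ' : IsArithFrobAt (𝓞 L) (absGaloisOuterConj ℚ L γ ρ) (outerConjIdeal γ 𝔔) :=
      (isArithFrobAt_absGaloisOuterConj_iff h𝔔 γ ρ).mpr hρ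
    have h𝔔' := outerConjIdeal_mem_primesAbove h𝔔 γ
    have h1 : Art ρ = ClassGroup.mk0 ⟨w.asIdeal, asIdeal_mem_nonZeroDivisors w⟩ := by
      rw [hArt_apply, hilbertClassField.absRestrictNormalHom_eq_artinEquiv_mk0 L h𝔔 hρ, MulEquiv.symm_apply_apply]
    have h2 : A ρ = ClassGroup.mk0 ⟨(absGaloisQuot ℚ L γ • w).asIdeal, asIdeal_mem_nonZeroDivisors _⟩ := by
      rw [hA_apply, hilbertClassField.absRestrictNormalHom_eq_artinEquiv_mk0 L h𝔔' hρ', MulEquiv.symm_apply_apply]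
    show a (ClassGroup.mk0 ⟨w.asIdeal, asIdeal_mem_nonZeroDivisors w⟩) =
      ClassGroup.mulEquiv (AmbiguousClass.intAut (absGaloisQuot ℚ L γ)) (ClassGroup.mk0 ⟨w.asIdeal, asIdeal_mem_nonZeroDivisors w⟩)
    rw [mulEquiv_mk0_prime_eq, ← h2, ← ha_comp, h1]
  -- conclude at `σ`
  have := ha_comp σ
  rw [hagree, MulEquiv.coe_toMonoidHom, hArt_apply] at this
  rw [← hA_apply, ← this]

end Equivariance

/-! ## §2 Lifting a non-zero equivariant character of `Cl(L)` to `Γ_L` -/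

section Lift

variable {p : ℕ} [Fact p.Prime] {L : Type} [Field L] [NumberField L] [IsAbelianGalois ℚ L]

/-- **`κ = g ∘ Art` inherits the eigen-law from `g`** (Artin equivariance): if `g(γ̄ · c) = g(c)^{(r γ).val}` for all `γ`, `c`, then
`κ(θ_γ σ) = κ(σ)^{(r γ).val}` — the converse bookkeeping of `classGroupHom_mulEquiv_eq_pow_val`.
[cite: NeukirchANT1999, Ch. IV §6 and Ch. VI §7 Thm. (7.1)] -/
theorem absGaloisHom_artin_eigen (g : ClassGroup (𝓞 L) →* Multiplicative (ZMod p))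
    (r : absoluteGaloisGroup ℚ →* (ZMod p)ˣ)
    (hg : ∀ (γ : absoluteGaloisGroup ℚ) (c : ClassGroup (𝓞 L)),
      g (ClassGroup.mulEquiv (AmbiguousClass.intAut (absGaloisQuot ℚ L γ)) c) = g c ^ ((r γ : (ZMod p)ˣ) : ZMod p).val)
    (γ : absoluteGaloisGroup ℚ) (σ : absoluteGaloisGroup L) :
    g ((hilbertClassField.artinEquiv L).symm (absRestrictNormalHom (hilbertClassField L) (absGaloisOuterConj ℚ L γ σ))) =
      g ((hilbertClassField.artinEquiv L).symm (absRestrictNormalHom (hilbertClassField L) σ)) ^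
        ((r γ : (ZMod p)ˣ) : ZMod p).val := by
  haveI : IsGalois ℚ L := IsAbelianGalois.toIsGalois
  rw [artin_absGaloisOuterConj L γ σ, hg]

/-- **A NON-ZERO EVERYWHERE-UNRAMIFIED `r`-EIGEN CHARACTER OF `Γ_L` from `e_ψ(ℤ_p ⊗ Cl L) ≠ 0`.** `L/ℚ` abelian, `p ∤ [L:ℚ]`,
`ψ : Gal(L/ℚ) →* ℤ_pˣ` with reduction `θ̄`, `r : Γ_ℚ →* 𝔽_pˣ` with `r γ = θ̄(γ̄)`; if `e_ψ(ℤ_p ⊗ Cl L) ≠ ⊥` there is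
`κ : Γ_L →* 𝔽_p` (multiplicative copy) with `κ ≠ 1`, OPEN kernel, `κ = 1` on every inertia group `I_𝔓` (`𝔓` a prime of `ℤ̄_L`),
and `κ(θ_γ σ) = κ(σ)^{(r γ).val}` for all `γ ∈ Γ_ℚ`, `σ ∈ Γ_L` — i.e. the data of stub O's `absGaloisHom_eq_one_final` with the
conclusion NEGATED. (`κ = g ∘ Art`, `g` from `exists_classGroupHom_ne_one_of_chiComponent_ne_bot`; unramified because `H/L` is;
open kernel because `Gal(L̄/H)` is.) [cite: NeukirchANT1999, Ch. VI §6 Prop. (6.9), §7 Thm. (7.1)] [cite: Washington1997, §6.3] -/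
theorem exists_absGaloisHom_ne_one_of_chiComponent_ne_bot (hpL : ¬ p ∣ Module.finrank ℚ L)
    (ψ : (L ≃ₐ[ℚ] L) →* ℤ_[p]ˣ) (θ : (L ≃ₐ[ℚ] L) →* (ZMod p)ˣ)
    (hθ : ∀ σ : L ≃ₐ[ℚ] L, PadicInt.toZMod ((ψ σ : ℤ_[p]ˣ) : ℤ_[p]) = ((θ σ : (ZMod p)ˣ) : ZMod p))
    (r : absoluteGaloisGroup ℚ →* (ZMod p)ˣ) (hr : ∀ γ : absoluteGaloisGroup ℚ, r γ = θ (absGaloisQuot ℚ L γ))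
    (hne : classGroupChiComponent ℚ L p (fun σ => ((ψ σ : ℤ_[p]ˣ) : ℤ_[p])) ≠ ⊥) :
    ∃ κ : absoluteGaloisGroup L →* Multiplicative (ZMod p), κ ≠ 1 ∧ IsOpen (κ.ker : Set (absoluteGaloisGroup L)) ∧
      (∀ (v : HeightOneSpectrum (𝓞 L)) (𝔓 : Ideal (absIntegers (𝓞 L) L)), 𝔓 ∈ v.primesAbove →
        ∀ g ∈ 𝔓.inertia (absoluteGaloisGroup L), κ g = 1) ∧
      (∀ (γ : absoluteGaloisGroup ℚ) (σ : absoluteGaloisGroup L),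
        κ (absGaloisOuterConj ℚ L γ σ) = (κ σ) ^ ((r γ : (ZMod p)ˣ) : ZMod p).val) := by
  haveI : IsGalois ℚ L := IsAbelianGalois.toIsGalois
  obtain ⟨g, hg1, hg⟩ := exists_classGroupHom_ne_one_of_chiComponent_ne_bot hpL ψ θ hθ hne
  set Art : absoluteGaloisGroup L →* ClassGroup (𝓞 L) :=
    (hilbertClassField.artinEquiv L).symm.toMonoidHom.comp (absRestrictNormalHom (hilbertClassField L)) with hArt
  have hArt_apply : ∀ ρ : absoluteGaloisGroup L,
      Art ρ = (hilbertClassField.artinEquiv L).symm (absRestrictNormalHom (hilbertClassField L) ρ) := fun ρ => rfl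
  refine ⟨g.comp Art, ?_, ?_, ?_, ?_⟩
  · -- `κ ≠ 1`: `Art` is onto and `g ≠ 1`
    intro h1
    apply hg1
    ext c
    obtain ⟨ρ, hρ⟩ := absRestrictNormalHom_surjective (hilbertClassField L) (hilbertClassField.artinEquiv L c)
    have := DFunLike.congr_fun h1 ρ
    change g (Art ρ) = (1 : absoluteGaloisGroup L →* Multiplicative (ZMod p)) ρ at this
    rw [hArt_apply, hρ, MulEquiv.symm_apply_apply, MonoidHom.one_apply] at this
    rw [this, MonoidHom.one_apply]
  · -- open kernel: it contains the open subgroup `Gal(L̄/H) = ker (Γ_L → Gal(H/L))`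
    apply Subgroup.isOpen_mono (H₁ := (hilbertClassField L).fixingSubgroup)
    · intro ρ hρ
      have h1 : absRestrictNormalHom (hilbertClassField L) ρ = 1 :=
        (absRestrictNormalHom_eq_one_iff_forall_smul (hilbertClassField L) ρ).mpr
          (fun x => (IntermediateField.mem_fixingSubgroup_iff _ _).mp hρ x x.2)
      change g (Art ρ) = 1
      rw [hArt_apply, h1, map_one, map_one]
    · exact IntermediateField.fixingSubgroup_isOpen (hilbertClassField L)
  · -- unramified everywhere: `H/L` is
    intro v 𝔓 h𝔓 ρ hρ
    have h1 : absRestrictNormalHom (hilbertClassField L) ρ = 1 :=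
      (isUnramifiedIn_iff_forall_inertia_absRestrictNormalHom_eq_one (hilbertClassField L) v).mp
        (hilbertClassField.isUnramifiedIn L v) 𝔓 h𝔓 ρ hρ
    change g (Art ρ) = 1
    rw [hArt_apply, h1, map_one, map_one]
  · intro γ σ
    change g (Art (absGaloisOuterConj ℚ L γ σ)) = g (Art σ) ^ _
    rw [hArt_apply, hArt_apply]
    exact absGaloisHom_artin_eigen g r (fun γ c => by rw [hg, hr]) γ σ

end Lift

/-! ## §3 With Mazur–Wiles: class factor non-unit ⟹ the odd vanishing FAILS -/

section MazurWiles

variable {p : ℕ} [Fact p.Prime] {L : Type} [Field L] [NumberField L] [IsAbelianGalois ℚ L]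

/-- **THE IRREGULARITY WITNESS ON `Γ_L` (CONDITIONAL on Mazur–Wiles Thm. 2, Ribet direction).** `p` odd, `L/ℚ` abelian with
`p ∤ [L:ℚ]`, `χ` primitive odd non-Teichmüller with `0 < ‖B_{1,χ⁻¹}‖_p < 1` (CLASS FACTOR NON-UNIT), `φ : Γ_ℚ →* ℤ_pˣ` trivial on
`Γ_L` with `φ = χ ∘ χ_f` and reduction `r`. Then there is `κ : Γ_L →* 𝔽_p`, `κ ≠ 1`, with open kernel, killing every inertia group,
and with the eigen-law `κ(θ_γ σ) = κ(σ)^{r(γ)}` — so the conclusion of stub O's `absGaloisHom_eq_one_final` FAILS for this `(L, χ, φ, r)`.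
The binders are those of `absGaloisHom_eq_one_final` plus `hMW`, `‖B‖ < 1` in place of `‖B‖ = 1`. CONDITIONAL on `hMW`;
closes nothing; BSD is not proved by any of this. [cite: MazurWiles1984, Thm. 2 (p. 216) — via Solomon1990, §I p. 468]
[cite: NeukirchANT1999, Ch. VI §7 Thm. (7.1)] [cite: Washington1997, §6.3] -/
theorem exists_absGaloisHom_ne_one_of_norm_bernoulli_lt_one
    (hMW : MazurWiles1984.thm2_card_oddChiClassGroup_eq_bernoulli) (hp2 : p ≠ 2) (hpL : ¬ p ∣ Module.finrank ℚ L)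
    {f : ℕ} [NeZero f] {χ : DirichletCharacter ℚ_[p] f} (hprim : χ.IsPrimitive) (hodd : χ.Odd)
    (hχω : ¬ ∀ a : ℤ, ¬ ((p : ℤ) ∣ a) → ‖χ (a : ZMod f) - (a : ℚ_[p])‖ < 1)
    (φ : absoluteGaloisGroup ℚ →* ℤ_[p]ˣ)
    (hφL : ∀ σ : absoluteGaloisGroup L, φ (absGaloisRestrict ℚ L σ) = 1)
    (hφχ : ∀ τ : absoluteGaloisGroup ℚ,
      (((φ τ : ℤ_[p]ˣ) : ℤ_[p]) : ℚ_[p]) = χ ((modNCyclotomicCharacter ℚ f τ : (ZMod f)ˣ) : ZMod f))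
    (hB0 : KrizLi2019.bernoulliOnePrim χ⁻¹ ≠ 0) (hB : ‖KrizLi2019.bernoulliOnePrim χ⁻¹‖ < 1)
    (r : absoluteGaloisGroup ℚ →* (ZMod p)ˣ)
    (hr : ∀ τ : absoluteGaloisGroup ℚ, PadicInt.toZMod ((φ τ : ℤ_[p]ˣ) : ℤ_[p]) = ((r τ : (ZMod p)ˣ) : ZMod p)) :
    ∃ κ : absoluteGaloisGroup L →* Multiplicative (ZMod p), κ ≠ 1 ∧ IsOpen (κ.ker : Set (absoluteGaloisGroup L)) ∧
      (∀ (v : HeightOneSpectrum (𝓞 L)) (𝔓 : Ideal (absIntegers (𝓞 L) L)), 𝔓 ∈ v.primesAbove →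
        ∀ g ∈ 𝔓.inertia (absoluteGaloisGroup L), κ g = 1) ∧
      (∀ (γ : absoluteGaloisGroup ℚ) (σ : absoluteGaloisGroup L),
        κ (absGaloisOuterConj ℚ L γ σ) = (κ σ) ^ ((r γ : (ZMod p)ˣ) : ZMod p).val) := by
  haveI : IsGalois ℚ L := IsAbelianGalois.toIsGalois
  -- the character `ψ` of `Gal(L/ℚ)` through which `φ` factors, and its reduction `θ̄`
  obtain ⟨ψ, hψ⟩ := exists_factor_absGaloisQuot ℚ L φ hφL
  let θ : (L ≃ₐ[ℚ] L) →* (ZMod p)ˣ := (Units.map (PadicInt.toZMod (p := p)).toMonoidHom).comp ψ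
  have hθ : ∀ σ : L ≃ₐ[ℚ] L, PadicInt.toZMod ((ψ σ : ℤ_[p]ˣ) : ℤ_[p]) = ((θ σ : (ZMod p)ˣ) : ZMod p) :=
    fun σ => rfl
  have hψχ : ∀ τ : absoluteGaloisGroup ℚ, (((ψ (absGaloisQuot ℚ L τ) : ℤ_[p]ˣ) : ℤ_[p]) : ℚ_[p]) =
      χ ((modNCyclotomicCharacter ℚ f τ : (ZMod f)ˣ) : ZMod f) := fun τ => by rw [hψ τ]; exact hφχ τ
  have hrθ : ∀ γ : absoluteGaloisGroup ℚ, r γ = θ (absGaloisQuot ℚ L γ) := fun γ => by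
    apply Units.ext
    rw [← hr γ, ← hθ, hψ γ]
  exact exists_absGaloisHom_ne_one_of_chiComponent_ne_bot hpL ψ θ hθ r hrθ
    (classGroupChiComponent_ne_bot_of_norm_bernoulli_lt_one hMW hp2 hpL hprim hodd hχω hψχ hB0 hB)

end MazurWiles

end Summit.BirchSwinnertonDyer.BirchSwinnertonDyer.Theorems.PrintCFram.HerbrandOddClassGroup

end
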